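import Summits.AtomisticToContinuum.Crystallization.Theorems.PerronTransitivityNoFractionalGainStubCertificate
import Summits.AtomisticToContinuum.Crystallization.Theorems.ThreeConeCertificateSlackRigidityPricedFloorsReadoff

/-!
# Heart of line `merge-perron`, crux `PerronTransitivity.NoFractionalGain` (stmt-AtomisticToContinuum-15098):
# the tightness case — weighted finite pieces of a separated hcp crystal

The heart stub `stub_perronWeights` asks, for every e_LJ-optimal hcp scale and every `2^{-1/6}`-separated
finite configuration `x`, for positive site weights `w` that are `Λ_hcp`-superharmonic for the binding
kernel `[−V_LJ(dist xᵢ xⱼ)]`, `Λ_hcp = −2 e_LJ(hcp a h)`.  This file proves the case in which the bound is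
SHARP: `x` an injective finite family of points of a separated hcp crystal (any scale `(a, h)`, optimal or
not), with `w ≡ 1`.  Mechanism: every finite site sum `Σ_{j≠i} V_LJ(dist xᵢ xⱼ)` omits only non-positive
terms of the full lattice sum at `xᵢ`, which equals `2 e_LJ(hcp a h)` at EVERY site by vertex-transitivity
of hcp (`SlackRigidityPricedFloorsReadoff.tsum_ne_eq_tsum_ne_zero`, `energyPerParticle_hcp_eq`); the
one-centre certificate (`lj_quadForm_ge_of_rowSum_le`, landed with `stub_certificate`) then gives the norm
bound `2 e_LJ(hcp a h) Σcᵢ² ≤ Σ_{i≠j} cᵢcⱼV_ij` for all real `c`.  The same argument covers finite pieces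
of ANY separated periodic configuration none of whose sites is bound better than `Λ_hcp` (all Frank–Kasper
phases numerically); the open content of the heart is configurations with super-bound sites.
-/

noncomputable section

namespace Summit.AtomisticToContinuum.Crystallization.Theorems.PerronTransitivity.NoFractionalGain

open Literature.MathematicalPhysics.StatisticalMechanics
open Summit.AtomisticToContinuum.Crystallization.Theorems
open scoped BigOperators


/-- Pairs at `dist⁶ ≥ 1/2` attract: `V_LJ(r) ≤ 0` whenever `1/2 ≤ r⁶`
(`V = u(u − 2)/12` with `u = r⁻⁶ ∈ [0, 2]`). [folklore] -/
theorem lennardJones_nonpos_of_half_le_pow_six {r : ℝ} (hr : (1 : ℝ) / 2 ≤ r ^ 6) :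
    lennardJones r ≤ 0 := by
  have hr6 : 0 < r ^ 6 := lt_of_lt_of_le (by norm_num) hr
  have hu0 : 0 ≤ (r⁻¹) ^ 6 := by positivity
  have hu2 : (r⁻¹) ^ 6 ≤ 2 := by
    rw [inv_pow, inv_le_comm₀ hr6 (by norm_num : (0 : ℝ) < 2)]
    linarith
  have h12 : (r⁻¹) ^ 12 = ((r⁻¹) ^ 6) ^ 2 := by ring
  unfold lennardJones
  rw [h12]
  nlinarith

/-- **Site sums of a finite subset of a separated hcp crystal are at least `2·e_LJ(hcp a h)`.**  If the
points of `hcpPeriodicConfiguration a h` are `2^{-1/6}`-separated (every pair attracts) and `x` is an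
injective family of its points, then for every `i` the finite site sum `Σ_{j≠i} V_LJ(dist xᵢ xⱼ)` is
bounded below by the full lattice sum `Σ'_{y ∈ hcp, y ≠ xᵢ} V_LJ(dist xᵢ y) = 2·e_LJ(hcp a h)`
(vertex-transitivity: `tsum_ne_eq_tsum_ne_zero`, `energyPerParticle_hcp_eq`), because every omitted term
is `≤ 0`. [folklore] -/
theorem two_mul_energyPerParticle_hcp_le_siteSum {a h : ℝ} (ha : 0 < a) (hh : 0 < h)
    (hsepP : ∀ p ∈ (hcpPeriodicConfiguration ha.ne' hh.ne').points,
      ∀ q ∈ (hcpPeriodicConfiguration ha.ne' hh.ne').points, p ≠ q → (1 : ℝ) / 2 ≤ dist p q ^ 6)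
    {N : ℕ} (x : Fin N → EuclideanSpace ℝ (Fin 3)) (hx : Function.Injective x)
    (hmem : ∀ i, x i ∈ (hcpPeriodicConfiguration ha.ne' hh.ne').points) (i : Fin N) :
    2 * (hcpPeriodicConfiguration ha.ne' hh.ne').energyPerParticle lennardJones ≤
      ∑ j ∈ Finset.univ.erase i, lennardJones (dist (x i) (x j)) := by
  classical
  set P := hcpPeriodicConfiguration ha.ne' hh.ne' with hP
  -- the full site sum at `x i` equals `2 e(hcp)`
  have hsite : ∑' y : {y : EuclideanSpace ℝ (Fin 3) // y ∈ P.points ∧ y ≠ x i},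
      lennardJones (dist (x i) y.1) = 2 * P.energyPerParticle lennardJones := by
    rw [SlackRigidityPricedFloorsReadoff.tsum_ne_eq_tsum_ne_zero ha.ne' hh.ne' (hmem i),
      SlackRigidityPricedFloorsReadoff.energyPerParticle_hcp_eq ha.ne' hh.ne']
    ring
  -- every term of the site sum is `≤ 0`
  have hnonpos : ∀ y : {y : EuclideanSpace ℝ (Fin 3) // y ∈ P.points ∧ y ≠ x i},
      lennardJones (dist (x i) y.1) ≤ 0 := fun y =>
    lennardJones_nonpos_of_half_le_pow_six (hsepP _ (hmem i) _ y.2.1 (Ne.symm y.2.2))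
  have hsum : HasSum (fun y : {y : EuclideanSpace ℝ (Fin 3) // y ∈ P.points ∧ y ≠ x i} =>
      lennardJones (dist (x i) y.1)) (2 * P.energyPerParticle lennardJones) := by
    rw [← hsite]
    exact (P.summable_lennardJones_dist_three (x i)).hasSum
  -- the finite family `j ≠ i` embeds into the index type of the site sum
  let φ : {j // j ∈ Finset.univ.erase i} → {y : EuclideanSpace ℝ (Fin 3) // y ∈ P.points ∧ y ≠ x i} :=
    fun j => ⟨x j.1, hmem j.1, hx.ne (Finset.ne_of_mem_erase j.2)⟩
  have hφ : Function.Injective φ := by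
    intro j j' hjj'
    have : x j.1 = x j'.1 := congrArg Subtype.val hjj'
    exact Subtype.ext (hx this)
  set S : Finset {y : EuclideanSpace ℝ (Fin 3) // y ∈ P.points ∧ y ≠ x i} :=
    Finset.univ.image φ with hS
  have hfin : ∑ j ∈ Finset.univ.erase i, lennardJones (dist (x i) (x j)) =
      ∑ y ∈ S, lennardJones (dist (x i) y.1) := by
    rw [hS, Finset.sum_image fun j _ j' _ h => hφ h, ← Finset.sum_attach (Finset.univ.erase i)]
    rfl
  -- partial sums of a non-positive family dominate its sum
  have hneg : ∑ y ∈ S, -lennardJones (dist (x i) y.1) ≤ -(2 * P.energyPerParticle lennardJones) :=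
    sum_le_hasSum S (fun y _ => by linarith [hnonpos y]) hsum.neg
  rw [Finset.sum_neg_distrib] at hneg
  rw [hfin]
  linarith

/-- **Stub `stub_perronWeightsHcpCase` (registered sub-goal of the heart, stmt-AtomisticToContinuum-15098): the heart
holds on its own extremiser** (tightness case of `stub_perronWeights`, weights `w ≡ 1`):
for every hcp scale `(a, h)` whose crystal is `2^{-1/6}`-separated and every injective finite family `x`
of its points, the constant weights are `Λ_hcp`-superharmonic for the binding kernel,
`Σ_{j≠i} [−V_LJ(dist xᵢ xⱼ)] ≤ −2·e_LJ(hcp a h)` at every site — so, by `stub_certificate`,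
`Σ_{i≠j} cᵢcⱼV_ij ≥ 2 e_LJ(hcp a h) Σcᵢ²` for all real `c` on every weighted finite piece of hcp (sharp as
the piece exhausts the crystal).  No optimality of `(a, h)` is needed for this case. [folklore] -/
theorem stub_perronWeightsHcpCase : ∀ (a h : ℝ) (ha : 0 < a) (hh : 0 < h),
    (∀ p ∈ (hcpPeriodicConfiguration ha.ne' hh.ne').points,
      ∀ q ∈ (hcpPeriodicConfiguration ha.ne' hh.ne').points, p ≠ q → (1 : ℝ) / 2 ≤ dist p q ^ 6) →
    ∀ (N : ℕ) (x : Fin N → EuclideanSpace ℝ (Fin 3)), Function.Injective x →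
      (∀ i, x i ∈ (hcpPeriodicConfiguration ha.ne' hh.ne').points) →
      ∃ w : Fin N → ℝ, (∀ i, 0 < w i) ∧
        ∀ i, ∑ j ∈ Finset.univ.erase i, -lennardJones (dist (x i) (x j)) * w j ≤
          -2 * (hcpPeriodicConfiguration ha.ne' hh.ne').energyPerParticle lennardJones * w i := by
  intro a h ha hh hsepP N x hx hmem
  refine ⟨fun _ => 1, fun _ => one_pos, fun i => ?_⟩
  have h := two_mul_energyPerParticle_hcp_le_siteSum ha hh hsepP x hx hmem i
  have hre : ∑ j ∈ Finset.univ.erase i, -lennardJones (dist (x i) (x j)) * (1 : ℝ) =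
      -∑ j ∈ Finset.univ.erase i, lennardJones (dist (x i) (x j)) := by
    rw [← Finset.sum_neg_distrib]
    exact Finset.sum_congr rfl fun j _ => by ring
  rw [hre]
  linarith

/-- Consequently the norm bound of the heart holds on weighted finite pieces of a separated hcp crystal:
`2·e_LJ(hcp a h)·Σcᵢ² ≤ Σ_{i≠j} cᵢcⱼV_LJ(dist xᵢ xⱼ)` for all real `c`. [folklore] -/
theorem perronKepler_on_hcp_subsets {a h : ℝ} (ha : 0 < a) (hh : 0 < h)
    (hsepP : ∀ p ∈ (hcpPeriodicConfiguration ha.ne' hh.ne').points,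
      ∀ q ∈ (hcpPeriodicConfiguration ha.ne' hh.ne').points, p ≠ q → (1 : ℝ) / 2 ≤ dist p q ^ 6)
    {N : ℕ} (x : Fin N → EuclideanSpace ℝ (Fin 3)) (hx : Function.Injective x)
    (hmem : ∀ i, x i ∈ (hcpPeriodicConfiguration ha.ne' hh.ne').points) (c : Fin N → ℝ) :
    2 * (hcpPeriodicConfiguration ha.ne' hh.ne').energyPerParticle lennardJones * ∑ i, c i ^ 2 ≤
      ∑ i, ∑ j ∈ Finset.univ.erase i, c i * c j * lennardJones (dist (x i) (x j)) := by
  have hattr : ∀ i j, i ≠ j → lennardJones (dist (x i) (x j)) ≤ 0 := fun i j hij =>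
    lennardJones_nonpos_of_half_le_pow_six (hsepP _ (hmem i) _ (hmem j) (hx.ne hij))
  have hrow : ∀ i, -∑ j ∈ Finset.univ.erase i, lennardJones (dist (x i) (x j)) ≤
      -(2 * (hcpPeriodicConfiguration ha.ne' hh.ne').energyPerParticle lennardJones) := fun i =>
    neg_le_neg (two_mul_energyPerParticle_hcp_le_siteSum ha hh hsepP x hx hmem i)
  have h := lj_quadForm_ge_of_rowSum_le x _ hattr hrow c
  linarith

end Summit.AtomisticToContinuum.Crystallization.Theorems.PerronTransitivity.NoFractionalGain

end
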